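import Literature.AlgebraicGeometry.HodgeTheory.HodgeRiemannPolarizabilityProofs
import Literature.AlgebraicGeometry.HodgeTheory.GysinKernelSplitHolds
import HarnessLib

/-!
# Discharge of `curveNetSaitoData_nonempty` (Saito 1990, Thm. 0.1–0.2, §2.g, §4.5)

Topic `Literature/AlgebraicGeometry/HodgeTheory`. The named fact `curveNetSaitoData_nonempty`
(`SaitoGrFDeRhamCurveNet.lean`: for a curve net `N` on a complex variety `X` with `2 ≤ m`, Saito's
graded de Rham package `CurveNetSaitoData N` exists) is PROVED here, by assembling the tree's
reductions, all of whose hypotheses are now theorems: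

* `curveNetSaitoData_nonempty_of_deligne` (`HodgeRiemannPolarizabilityProofs.lean`): the named fact
  follows from Deligne's *Hodge III* Cor. 8.2.8
  (`Deligne1974_ker_restrictCompl_eq_iSup_range_complexGysin`), real Hodge models
  (`exists_isReal_hodgeModel_holds`), de Rham's theorem (`exists_deRhamIsoFamily_holds`) and the
  polarizability of the Hodge structures of smooth projective varieties
  (`smoothProjective_hodgeStructure_isPolarizable_holds`) being proved;
* `Deligne1974_ker_restrictCompl_eq_iSup_range_complexGysin_holds_of` (`GysinKernelSplit.lean`):
  Cor. 8.2.8 from Prop. 8.2.7 (`Deligne1974_ker_pullback_eq_ker_pullback_resolution`) by Poincaré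
  duality (`ThomGysinClosedImmersion.lean`);
* `Deligne1974_ker_pullback_eq_ker_pullback_resolution_holds` (`GysinKernelSplitHolds.lean`):
  Prop. 8.2.7, proved through log resolution, the `∂∂̄`-lemma on the compact Kähler strata of the
  simple normal crossing boundary, and tautness.

Saito's own proof (M. Saito, *Mixed Hodge modules*, Publ. RIMS 26 (1990), Thm. 0.1 (existence of
`MHM(X)` with the six operations, p. 221), Thm. 0.2 (the decomposition / graded de Rham package,
p. 222), §2.g (`Gr^F DR`, pp. 252–253) and (4.5.6)–(4.5.9) (polarizable Hodge modules on curves and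
their nets, pp. 323–325)) goes through the theory of mixed Hodge modules; the tree's statement
`curveNetSaitoData_nonempty` pins exactly the classical Hodge-theoretic content of that package for
curve nets (`SaitoGrFDeRhamCurveNet.lean`, "Faithfulness"), and the classical anchor
(`SaitoGrFDeRhamCurveNetClassical.lean`) reduces it to the pure Hodge theory of smooth projective
varieties plus Deligne's Cor. 8.2.8, which is the road taken here. No new named facts (D-0026).

## References

* [Saito1990] M. Saito, *Mixed Hodge modules*, Publ. RIMS Kyoto Univ. 26 (1990), 221–333,
  Thm. 0.1–0.2, §2.g, §4.5. doi:10.2977/prims/1195171082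
* [DeligneHodgeIII1974] P. Deligne, *Théorie de Hodge III*, Publ. Math. IHÉS 44 (1974), Prop. 8.2.7,
  Cor. 8.2.8 (p. 40).
-/

noncomputable section

namespace Literature.AlgebraicGeometry.HodgeTheory

/-- **Deligne, Hodge III, Cor. 8.2.8 — discharge of the named fact
`Deligne1974_ker_restrictCompl_eq_iSup_range_complexGysin`**: the kernel of
`Hᵇ(X(ℂ); ℂ) → Hᵇ((X ∖ ⋃ g_j(Y_j))(ℂ); ℂ)` is the sum of the Gysin images, for a smooth projective
`X` and morphisms `g_j : Y_j → X` from smooth projective `Y_j` — from its proved child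
`Deligne1974_ker_pullback_eq_ker_pullback_resolution_holds` (Prop. 8.2.7) through the split
`Deligne1974_ker_restrictCompl_eq_iSup_range_complexGysin_holds_of`.
[cite: DeligneHodgeIII1974, Prop. 8.2.7 and Cor. 8.2.8 (p. 40)] -/
theorem Deligne1974_ker_restrictCompl_eq_iSup_range_complexGysin_holds :
    Deligne1974_ker_restrictCompl_eq_iSup_range_complexGysin :=
  Deligne1974_ker_restrictCompl_eq_iSup_range_complexGysin_holds_of
    Deligne1974_ker_pullback_eq_ker_pullback_resolution_holds

/-- **Saito 1990, Thm. 0.1–0.2 with §2.g and (4.5.6)–(4.5.9) — discharge of the named fact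
`curveNetSaitoData_nonempty`**: for every curve net `N : CurveNet m X` on a complex variety with
`2 ≤ m`, Saito's graded de Rham package `CurveNetSaitoData N` exists. Proof: the classical anchor
(`curveNetSaitoData_nonempty_of_deligne`: real Hodge models, de Rham's theorem, polarizability of
the Hodge structures of smooth projective varieties — all proved in the tree) fed with Deligne's
Cor. 8.2.8 (`Deligne1974_ker_restrictCompl_eq_iSup_range_complexGysin_holds`).
[cite: Saito1990, Thm. 0.1 (p. 221), Thm. 0.2 (p. 222), §2.g (pp. 252–253), (4.5.6)–(4.5.9) (pp. 323–325)]
[cite: DeligneHodgeIII1974, Cor. 8.2.8] -/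
theorem curveNetSaitoData_nonempty_holds : curveNetSaitoData_nonempty :=
  curveNetSaitoData_nonempty_of_deligne Deligne1974_ker_restrictCompl_eq_iSup_range_complexGysin_holds

end Literature.AlgebraicGeometry.HodgeTheory

end
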